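import Literature.NumberTheory.EllipticCurves.Rank1Residual.Typed.PAdicCertificateReducibleMultiplicative
import Literature.NumberTheory.EllipticCurves.SteinWuthrich2013.MultiplicativeLeadingTerm
import Literature.NumberTheory.EllipticCurves.IwasawaSelmerModuleFiniteProofs
import HarnessLib

/-!
# X2 (reducible `E[p]`, multiplicative `p`) at analytic rank `≤ 1`: Wuthrich Thm. 16 ∘ Stein–Wuthrich Thm. 6.1 ∘ engine, no leading-term hypothesis (cell `b2b-bsdres`)

HONEST FRAMING (run/shared/lean/b2b/bsd-rank1-residual/, verbatim): the goal of the cell is to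
DELETE the COMBINATION-SHAPED residual classes for ALL analytic-rank `≤ 1` elliptic curves over `ℚ`
— "full BSD formula for every rank `≤ 1` curve in class C" assembled STRICTLY from published
theorems — so that the rank-`≤ 1` remainder becomes exactly the CONSTRUCTION-SHAPED classes, which
are TYPED (missing-input `Prop`s), NOT attempted. This is not "finishing BSD". Class X2 is and
stays CONSTRUCTION-SHAPED; this file only removes the one CLASS-LEVEL hypothesis of its per-curve
certificate route.

Theorems only (no definition, no new named fact). Companion of
`Typed/PAdicCertificateReducibleMultiplicative.lean` (literature seat gen 5, p181437: Wuthrich 2014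
Thm. 16 at a multiplicative prime, `Wuthrich2014.thm16_charIdeal_dvd_multiplicative_of_reducible`
p181356, ∘ the certificate engine), whose theorems carry the algebraic leading-term clause as the
hypothesis `hLT` ("Jones 1989"). Exactly as for X11 (`Typed/PAdicCertificateMultiplicativeCanonical.lean`,
x11a gen 7), that clause is the PUBLISHED named fact `SteinWuthrich2013.thm61_{split,nonsplit}Multiplicative`
(Stein–Wuthrich, Math. Comp. 82 (2013) Thm. 6.1 "(Schneider, Perrin-Riou, Jones)", held
`paper:url-055ad7d818a8` p. 20 — it has NO hypothesis on the image of Galois) for THE §4.2 height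
(`IsSplitMultCanonical Dh Dq` / `IsMultCanonical Dh q`), and `leadingTerm_shape` discharges `hLT`
(`A = 𝓛_p ∏ c_v`, `B = log_p(γ_cyc)^{r+1} #E(ℚ)_tors²` split; `A = 2 ∏ c_v`, `B = log_p(γ_cyc)^r
#E(ℚ)_tors²` non-split; `R = Reg_p(E, Dh)`). Inputs left: published named facts (`h16`, `hJ`,
`hGZK`, `h𝓛`), the class predicate `ClassX2 W p` (`p ≠ 2 ∧ red ∧ mult`), bookkeeping data of the
divisibility fact, `Dh` pinned, and the per-curve COMPUTED `hordL`, `hcert`, `hs`/`hv`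
(`p ∤ #Ш_an`). Per curve; no verdict or label changed (on the census the open X2 rank-one pairs with
`p ∤ #Ш_an` — RESIDUAL-CASES lever L3 — thereby have the same shape as X11: "PUB facts + per-curve
certificate about defined quantities").

References: Stein–Wuthrich 2013 Thm. 6.1, §4.2 [SteinWuthrich2013]; Wuthrich 2014 Thm. 16 (p. 393)
[Wuthrich2014]; Miller 2011 Prop. 7.6 [Miller2011LMS].
-/

set_option autoImplicit false

noncomputable section

open scoped Classical MatrixGroups ModularForm

open CongruenceSubgroup WeierstrassCurve Literature.NumberTheory.EllipticCurves
  Literature.NumberTheory.EllipticCurves.ModularForms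
  Literature.NumberTheory.EllipticCurves.Rank1Residual
  Literature.NumberTheory.EllipticCurves.Wuthrich2014
  Literature.NumberTheory.EllipticCurves.SteinWuthrich2013

namespace Literature.NumberTheory.EllipticCurves.Rank1Residual.Typed

/-- **X2, split multiplicative `p` (odd), analytic rank `≤ 1`, `p ∤ #Ш_an`: `BSD(E,p)` from
PUBLISHED facts (Wuthrich Thm. 16 `h16`, SW Thm. 6.1 `hJ`, GZK, BDGP `h𝓛`) plus the per-curve
certificate for THE Stein–Wuthrich height** (`hDh : IsSplitMultCanonical Dh Dq`; normalisers
`A = 𝓛_p ∏ c_v`, `B = log_p(γ_cyc)^{r+1} #E(ℚ)_tors²`, `R = Reg_p(E, Dh)`; computed `hordL`, `hcert`).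
`X2.bsdp_of_thm16mult_split_of_leadingTerm_certificate` with `hLT` DISCHARGED by
`hJ.leadingTerm_shape`. Per curve; X2 stays CONSTRUCTION-SHAPED (no deletion).
[cite: SteinWuthrich2013, Thm. 6.1 (p. 20) and §4.2] [cite: Wuthrich2014, Thm. 16 (p. 393)]
[cite: Miller2011LMS, Prop. 7.6] -/
theorem X2.bsdp_of_thm16mult_split_of_canonical_certificate
    (h16 : thm16_charIdeal_dvd_multiplicative_of_reducible) (hJ : thm61_splitMultiplicative)
    (hGZK : rank_eq_analyticRank_of_analyticRank_le_one)
    (W : WeierstrassCurve ℚ) [W.IsElliptic] [W.IsGloballyMinimal] (p : ℕ) [Fact p.Prime]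
    (h𝓛 : LInvariant_ne_zero (W := W) (p := p))
    {κ : ZpExtension ℚ p} {γ : Field.absoluteGaloisGroup ℚ} {N : ℕ} [NeZero N]
    {f : CuspForm (Gamma0 N) 2} (hr : W.analyticRank ≤ 1) (hX : ClassX2 W p)
    (Dq : TateParameterData W p) (Dh : PAdicHeightData W p) (hDh : IsSplitMultCanonical Dh Dq)
    (hκ : κ.IsCyclotomic) (hγ : κ.IsTopGenerator γ) (hγ' : IsCyclotomicVariable p γ)
    (hf : IsNewformOf W f) (D : W.SelmerDualData κ γ) (ϖ : ℚ) (hϖ0 : ϖ ≠ 0)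
    (hϖ : (ϖ : ℝ) * W.realPeriodRat = plusPeriod f)
    (L : PowerSeries ℚ_[p]) (hL : IsSplitMultPAdicLFunctionOf f p L)
    (hordL : L.order = (W.mordellWeilRank + 1 : ℕ))
    (hcert : (((ϖ : ℚ) : ℚ_[p]) * PowerSeries.coeff (W.mordellWeilRank + 1) L *
        (padicLog p (cyclotomicGenerator p) ^ (W.mordellWeilRank + 1) *
          (W.torsionOrder : ℚ_[p]) ^ 2)).valuation =
      (LInvariant Dq * (W.tamagawaProduct : ℚ_[p]) * padicRegulator Dh).valuation)
    {s : ℚ} (hs : shaAn W = (s : ℂ)) (hv : padicValRat p s = 0) : BSDp W p := by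
  obtain ⟨hp, hred, -⟩ := hX
  haveI : Module.Finite (IwasawaAlgebra p) D.X := D.module_finite_holds hγ
  have hXt : D.IsTorsion :=
    (h16 W p hp Dq.split.hasMultiplicativeReductionAtPrime hred hκ hγ hγ' hf D ϖ hϖ).1
  have hc0 : (W.tamagawaProduct : ℚ_[p]) ≠ 0 := by
    exact_mod_cast (W.tamagawaProduct_pos_holds : 0 < W.tamagawaProduct).ne'
  have hA0 : LInvariant Dq * (W.tamagawaProduct : ℚ_[p]) ≠ 0 := mul_ne_zero (h𝓛 Dq) hc0
  exact Typed.bsdp_of_thm16mult_split_of_leadingTerm_certificate h16 hGZK W p hp hr Dq.split hred hκ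
    hγ hγ' hf D ϖ hϖ0 hϖ L hL hordL _ _ (padicRegulator Dh) hA0
    (hJ.leadingTerm_shape hp Dq hκ hγ hγ' D hXt hDh) hcert hs hv

/-- **X2, NON-split multiplicative `p` (odd), analytic rank `≤ 1`, `p ∤ #Ш_an`: `BSD(E,p)` from
PUBLISHED facts plus the per-curve certificate for THE Stein–Wuthrich height** (formula (4.1);
`hDh : IsMultCanonical Dh q` for the Tate parameter `q`; `A = 2 ∏ c_v`, `B = log_p(γ_cyc)^r
#E(ℚ)_tors²`, `R = Reg_p(E, Dh)`). `X2.bsdp_of_thm16mult_nonsplit_of_leadingTerm_certificate` with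
`hLT` DISCHARGED. Per curve; X2 stays CONSTRUCTION-SHAPED. [cite: SteinWuthrich2013, Thm. 6.1 (p. 20), §3.1 (p. 9), §4.2]
[cite: Wuthrich2014, Thm. 16 (p. 393)] [cite: Miller2011LMS, Prop. 7.6] -/
theorem X2.bsdp_of_thm16mult_nonsplit_of_canonical_certificate
    (h16 : thm16_charIdeal_dvd_multiplicative_of_reducible) (hJ : thm61_nonsplitMultiplicative)
    (hGZK : rank_eq_analyticRank_of_analyticRank_le_one)
    (W : WeierstrassCurve ℚ) [W.IsElliptic] [W.IsGloballyMinimal] (p : ℕ) [Fact p.Prime]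
    {κ : ZpExtension ℚ p} {γ : Field.absoluteGaloisGroup ℚ} {N : ℕ} [NeZero N]
    {f : CuspForm (Gamma0 N) 2} (hr : W.analyticRank ≤ 1) (hX : ClassX2 W p)
    (hns : ¬ W.HasSplitMultiplicativeReductionAtPrime p)
    {q : ℚ_[p]} (hq0 : q ≠ 0) (hq1 : ‖q‖ < 1) (hqj : tateJ q = (W.j : ℚ_[p]))
    (Dh : PAdicHeightData W p) (hDh : IsMultCanonical Dh q)
    (hκ : κ.IsCyclotomic) (hγ : κ.IsTopGenerator γ) (hγ' : IsCyclotomicVariable p γ)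
    (hf : IsNewformOf W f) (D : W.SelmerDualData κ γ) (ϖ : ℚ) (hϖ0 : ϖ ≠ 0)
    (hϖ : (ϖ : ℝ) * W.realPeriodRat = plusPeriod f)
    (L : PowerSeries ℚ_[p]) (hL : IsMultPAdicLFunctionOf f p (-1) L)
    (hordL : L.order = (W.mordellWeilRank : ℕ))
    (hcert : (((ϖ : ℚ) : ℚ_[p]) * PowerSeries.coeff W.mordellWeilRank L *
        (padicLog p (cyclotomicGenerator p) ^ W.mordellWeilRank *
          (W.torsionOrder : ℚ_[p]) ^ 2)).valuation =
      (2 * (W.tamagawaProduct : ℚ_[p]) * padicRegulator Dh).valuation)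
    {s : ℚ} (hs : shaAn W = (s : ℂ)) (hv : padicValRat p s = 0) : BSDp W p := by
  obtain ⟨hp, hred, hmult⟩ := hX
  haveI : Module.Finite (IwasawaAlgebra p) D.X := D.module_finite_holds hγ
  have hXt : D.IsTorsion := (h16 W p hp hmult hred hκ hγ hγ' hf D ϖ hϖ).1
  have hc0 : (W.tamagawaProduct : ℚ_[p]) ≠ 0 := by
    exact_mod_cast (W.tamagawaProduct_pos_holds : 0 < W.tamagawaProduct).ne'
  have hA0 : (2 : ℚ_[p]) * (W.tamagawaProduct : ℚ_[p]) ≠ 0 := mul_ne_zero two_ne_zero hc0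
  exact Typed.bsdp_of_thm16mult_nonsplit_of_leadingTerm_certificate h16 hGZK W p hp hr hmult hns hred
    hκ hγ hγ' hf D ϖ hϖ0 hϖ L hL hordL _ _ (padicRegulator Dh) hA0
    (hJ.leadingTerm_shape hp hmult hns hq0 hq1 hqj hκ hγ hγ' D hXt hDh) hcert hs hv

end Literature.NumberTheory.EllipticCurves.Rank1Residual.Typed

end
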